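import Summits.BirchSwinnertonDyer.BirchSwinnertonDyer.Theorems.ManinLocalTwoThreeManinOddByLocus
import Summits.BirchSwinnertonDyer.BirchSwinnertonDyer.Theorems.ManinLocalTwoThreeManinOddAtFourOfOrdJLeZero
import HarnessLib

/-!
# C2 READ AT `16 ∣ N` AND `ord₂ j > 0` (potentially supersingular at 2): the `χ₋₄` rotation preserves `j`, so the LEAD's `16 ∣ N`
# reading and p2's `ord₂ j ≤ 0` theorem COMPOSE — skeleton v19 of `kato_shift_two` (route `ManinLocalTwoThree`, cell bsd-f2-manin;
# crux C2 `ManinOddAtFour` stmt-BirchSwinnertonDyer-22967; LEAD seat p1 gen 13)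

THE POINT.  Two kernel reductions of the crux are in the tree: (i) C2 ⟺ `ManinOddAtSixteen` (an/typer/p2: the `χ₋₄` rotation moves a
lattice-optimal datum with `4 ∥ N` or `8 ∥ N` to one with `16 ∣ N′` and the same constant; p2's S-an-58/S-an-60 theorems), (ii) C2 ⟸ C2 on
`ord₂ j > 0` (p2 g14 `maninOddAtFour_of_pos_ordJ`: every potentially multiplicative / potentially good ordinary class with `4 ∣ N` is a dyadic
twist of a `2`-semistable class, closed by print + the dyadic untwist transport).  A quadratic twist and a change of model preserve `j`
(`j_quadraticTwist`, `variableChange_j`), so the rotation of (i) carries the binder `ord₂ j > 0` of (ii) along: this file re-proves an's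
general optimal-partner construction with the MODEL exposed (`exists_optimalPartner_general_j`: `W′.j = W.j`), hence
`maninOddAtFourSS_of_maninOddAtSixteenSS` (C2 on {`ord₂ j > 0`} ⟸ C2 on {`ord₂ j > 0`, `16 ∣ N`}), and feeds it with the by-locus level-wise
composition with the `j`-binder threaded (`not_two_dvd_maninConstant_of_levelLaws_blindGuard_ss`).  RESULT:
**`maninOddAtFour_of_katoFact_of_levelSixteenSSLaws_blindPeriodRecut`** — the ROUTE DECL BY NAME from {F♯, F★, hex, F-es-21♭K} and THREE LAWS READ
ON {`16 ∣ N`} ∩ {`ord₂ j > 0`}: E-an-48, E-an-53 (at data with a non-blind rational 2-torsion point whose curve is potentially supersingular at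
`2`) and Kato–Néron integrality at the `X₁(N)`-optimal curve of TOTALLY BLIND potentially-supersingular classes off the period-dominated locus.

HONEST FRAMING.  A CONDITIONAL reduction and a re-indexing; the four facts are statement-only Literature readings; the three laws are OPEN (now on
the potentially supersingular `16 ∣ N` stratum only).  C2, Manin's conjecture, Stevens' conjecture and BSD are NOT proved.  No definitions, no sorry.
-/

set_option autoImplicit false
-- lint-debt: the directory name repeats the summit name (sibling precedent `ManinLocalTwoThreeGammaOneKatoRoad.lean`)
set_option linter.dupNamespace false

noncomputable section

open scoped Classical MatrixGroups ModularForm NumberField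
open PowerSeries CongruenceSubgroup IsDedekindDomain IsDedekindDomain.HeightOneSpectrum Rat.HeightOneSpectrum
open WeierstrassCurve Literature.NumberTheory.DiophantineGeometry Literature.NumberTheory.EllipticCurves
  Literature.NumberTheory.EllipticCurves.ModularForms Literature.RingTheory.FormalGroups
open Summit.BirchSwinnertonDyer.Rank1Residual.ManinAdditive
open Summit.BirchSwinnertonDyer.Rank1Residual.ManinAdditive.CuspidalKummer
open Summit.BirchSwinnertonDyer.Rank1Residual.ManinAdditive.ShimuraLedger
open Summit.BirchSwinnertonDyer.Rank1Residual.ManinAdditive.KatoCurve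

namespace Summit.BirchSwinnertonDyer.BirchSwinnertonDyer.Theorems.ManinLocalTwoThree

/-! ## §1 an's general optimal-partner construction with the MODEL exposed: `W′ = C • (W ⊗ (−1))`, hence `j(W′) = j(W)` -/

/-- **GENERAL OPTIMAL PARTNER with the same `j`** — an's `exists_optimalPartner_general` (B5b, typer p698181) re-proved VERBATIM with one extra
output: the partner `W′` is a model of `W ⊗ (−1)` (`∃ C, C • (W ⊗ (−1)) = W′`), so `W′.j = W.j` (`variableChange_j`, `j_quadraticTwist`).
[cite: Pal2012, Lemma 3.1 and Prop. 2.4] [cite: Stevens1989, Lemma (5.4) p. 97] -/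
theorem exists_optimalPartner_general_j (hnf : exists_isNewformOf)
    (W : WeierstrassCurve ℚ) [W.IsElliptic] [W.IsGloballyMinimal] [NeZero (W.conductorNorm ℤ)]
    (D : ModularParametrizationData W (W.conductorNorm ℤ)) (hD : IsLatticeOptimal D)
    (h4 : 2 ^ 2 ∣ W.conductorNorm ℤ) (m : ℕ) (hm4 : m ∣ 4) (h16 : 4 ^ 2 ∣ m * W.conductorNorm ℤ)
    (hNT0 : (haveI := W.isElliptic_quadraticTwist (show ((-1 : ℤ) : ℚ) ≠ 0 by norm_num);
      (W.quadraticTwist ((-1 : ℤ) : ℚ)).conductorNorm ℤ) = m * W.conductorNorm ℤ) :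
    ∃ (W' : WeierstrassCurve ℚ) (_ : W'.IsElliptic) (_ : W'.IsGloballyMinimal)
      (_ : NeZero (W'.conductorNorm ℤ)) (D' : ModularParametrizationData W' (W'.conductorNorm ℤ)),
      IsLatticeOptimal D' ∧ W'.conductorNorm ℤ = m * W.conductorNorm ℤ ∧
      IsIsogenous (W.quadraticTwist ((-1 : ℤ) : ℚ)) W' ∧ D'.c = D.c ∧ W'.j = W.j := by
  have hm0 : m ≠ 0 := by
    rintro rfl; exact absurd (zero_dvd_iff.mp hm4) (by norm_num)
  have hd0 : ((-1 : ℤ) : ℚ) ≠ 0 := by norm_num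
  haveI := W.isElliptic_quadraticTwist hd0
  set T := W.quadraticTwist ((-1 : ℤ) : ℚ) with hT
  have hNT : T.conductorNorm ℤ = m * W.conductorNorm ℤ := hNT0
  -- the minimal model `W′ = C • T`, `u(C)² = 1`
  obtain ⟨C, hmin⟩ := hasGlobalMinimalModel_rat_holds T
  haveI := hmin
  have hNW' : (C • T).conductorNorm ℤ = m * W.conductorNorm ℤ := by
    rw [WeierstrassCurve.conductorNorm_smul]; exact hNT
  haveI : NeZero ((C • T).conductorNorm ℤ) :=
    ⟨by rw [hNW']; exact mul_ne_zero hm0 (NeZero.ne _)⟩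
  have hM'' : 4 ^ 2 ∣ (C • T).conductorNorm ℤ := by rw [hNW']; exact h16
  have h4' : 2 ^ 2 ∣ (C • T).conductorNorm ℤ := dvd_trans ⟨4, by norm_num⟩ hM''
  have hNdvd : W.conductorNorm ℤ ∣ (C • T).conductorNorm ℤ := by rw [hNW']; exact Dvd.intro_left m rfl
  have hL : (C • T).conductorNorm ℤ ∣ 4 * W.conductorNorm ℤ := by
    obtain ⟨k, hk⟩ := hm4
    rw [hNW', hk]
    exact ⟨k, by ring⟩
  have hΔ : (C • T).Δ = W.Δ := negOneTwistMinimalDiscrEq_holds W (C • T) C h4 h4' rfl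
  have hu2 : ((C.u : ℚ)) ^ 2 = 1 :=
    u_sq_eq_one_of_smul_quadraticTwist_of_Δ hd0 C rfl (by rw [hΔ]; norm_num)
  have hu1 : (C.u : ℚ) = 1 ∨ (C.u : ℚ) = -1 := mul_self_eq_one_iff.mp (by rw [← pow_two]; exact hu2)
  -- the newform `g` of `W′` and the two-sided lattice step
  obtain ⟨g, hg⟩ := hnf (C • T)
  have hisoT : IsIsogenous T (C • T) := isIsogenous_smul T C
  obtain ⟨h₁, h₂⟩ := half_gaussSum_χ₄_twoSided_general D g hg h4 hM'' hNdvd hL hisoT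
  set s : ℂ := gaussSum (ZMod.χ₄.ringHomComp (Int.castRingHom ℂ)) (ZMod.stdAddChar (N := 4)) / 2
    with hs
  have hs2 : s ^ 2 = -1 := by
    rw [hs, div_pow, gaussSum_χ₄_ringHomComp_sq]; norm_num
  have hs0 : s ≠ 0 := fun h ↦ by rw [h] at hs2; norm_num at hs2
  have hs2' : s ^ 2 = ((((-1 : ℤ) : ℚ)) : ℂ) := by rw [hs2]; norm_num
  have hLT : IsNeronLatticeOf (T.baseChange ℂ) (D.L.mulLeft s⁻¹ (inv_ne_zero hs0)) :=
    isNeronLatticeOf_quadraticTwist_of_sq_eq ((-1 : ℤ) : ℚ) D.isNeronLattice hs0 hs2'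
  haveI : ((C • T).baseChange ℂ).IsElliptic := by rw [WeierstrassCurve.baseChange]; infer_instance
  obtain ⟨L', hL'⟩ := exists_isNeronLatticeOf_holds ((C • T).baseChange ℂ)
  have hlat := IsNeronLatticeOf.lattice_eq_mulLeft_of_smul C hLT hL'
  have huC0 : ((C.u : ℚ) : ℂ) ≠ 0 := by exact_mod_cast C.u.ne_zero
  have hmem : ∀ z : ℂ, z ∈ L'.lattice ↔ s * ((((C.u : ℚ) : ℂ))⁻¹ * z) ∈ D.L.lattice := fun z ↦ by
    rw [hlat, PeriodPair.mem_mulLeft_lattice, PeriodPair.mem_mulLeft_lattice, inv_inv]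
  have hεW : ∀ x : ℂ, (((C.u : ℚ) : ℂ))⁻¹ * x ∈ D.L.lattice ↔ x ∈ D.L.lattice := fun x ↦ by
    rcases hu1 with h | h <;> simp [h, neg_mem_iff]
  have hc0 : D.c ≠ 0 := D.maninConstant_ne_zero_holds
  have hc : ∀ z ∈ periodLattice g, (D.c : ℂ) * z ∈ L'.lattice := fun z hz ↦ by
    rw [hmem, ← mul_assoc, mul_comm s, mul_assoc, hεW, ← mul_assoc, mul_comm s, mul_assoc]
    · exact D.smul_periodLattice_le _ (h₁ z hz)
  obtain ⟨D', hf', hL'eq, hc'⟩ :=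
    PlusEtaManinInput.exists_modularParametrizationData_eq_of_smul_periodLattice_le hg hL' hc0 hc
  subst hf' hL'eq
  have hj : (C • T).j = W.j := by rw [variableChange_j]; exact W.j_quadraticTwist hd0
  refine ⟨C • T, inferInstance, hmin, inferInstance, D', ?_, hNW', hisoT, hc', hj⟩
  -- lattice-optimality of `D′`
  intro z hz
  rw [hmem, ← mul_assoc, mul_comm s, mul_assoc, hεW] at hz
  obtain ⟨w₀, hw₀, hzw⟩ := hD _ hz
  refine ⟨-(s * w₀), neg_mem (h₂ w₀ hw₀), ?_⟩
  rw [hc']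
  have hz' : z = -(s * (s * z)) := by
    rw [← mul_assoc, ← pow_two, hs2]; ring
  rw [hz', hzw]; ring

/-! ## §2 The rotation with the `j`-binder: C2 on {`ord₂ j > 0`} ⟸ C2 on {`ord₂ j > 0`, `16 ∣ N`} -/

/-- **Conductor level: the `4 ∣ N` range ⟸ the `16 ∣ N` stratum, `j` FIXED** (S-an-58 / S-an-60 theorems supply `N(W ⊗ (−1)) = 4N` at `4 ∥ N`
and `= 2N` at `8 ∥ N`; the partner of §1 has `16 ∣ N′`, the same constant and the same `j`). -/
theorem two_not_dvd_c_of_four_dvd_of_sixteen_dvd_stratum_ss (hnf : exists_isNewformOf)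
    (h16 : ∀ (W' : WeierstrassCurve ℚ) [W'.IsElliptic] [W'.IsGloballyMinimal] [NeZero (W'.conductorNorm ℤ)]
      (D' : ModularParametrizationData W' (W'.conductorNorm ℤ)),
      IsLatticeOptimal D' → 2 ^ 4 ∣ W'.conductorNorm ℤ →
      ((primesEquiv (R := 𝓞 ℚ)).symm ⟨2, Nat.prime_two⟩).valuation ℚ W'.j < 1 → ¬ (2 : ℤ) ∣ D'.c)
    (W : WeierstrassCurve ℚ) [W.IsElliptic] [W.IsGloballyMinimal] [NeZero (W.conductorNorm ℤ)]
    (D : ModularParametrizationData W (W.conductorNorm ℤ)) (hD : IsLatticeOptimal D)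
    (h4 : 2 ^ 2 ∣ W.conductorNorm ℤ)
    (hss : ((primesEquiv (R := 𝓞 ℚ)).symm ⟨2, Nat.prime_two⟩).valuation ℚ W.j < 1) : ¬ (2 : ℤ) ∣ D.c := by
  by_cases h16W : 2 ^ 4 ∣ W.conductorNorm ℤ
  · exact h16 W D hD h16W hss
  by_cases h8 : 2 ^ 3 ∣ W.conductorNorm ℤ
  · -- `8 ∥ N`: partner at `2N` (S-an-60)
    have hNT : (haveI := W.isElliptic_quadraticTwist (show ((-1 : ℤ) : ℚ) ≠ 0 by norm_num);
        (W.quadraticTwist ((-1 : ℤ) : ℚ)).conductorNorm ℤ) = (2 : ℕ) * W.conductorNorm ℤ := by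
      push_cast; exact negOneTwistConductorTwoMul_holds W h8 h16W
    obtain ⟨W', i1, i2, i3, D', hD', hN', -, hc', hj'⟩ := exists_optimalPartner_general_j hnf W D hD h4 2 ⟨2, rfl⟩
      (by obtain ⟨k, hk⟩ := h8; exact ⟨k, by rw [hk]; ring⟩) hNT
    have h16' : 2 ^ 4 ∣ W'.conductorNorm ℤ := by
      rw [hN']; obtain ⟨k, hk⟩ := h8; exact ⟨k, by rw [hk]; ring⟩
    rw [← hc']
    exact h16 W' D' hD' h16' (by rw [hj']; exact hss)
  · -- `4 ∥ N`: partner at `4N` (S-an-58)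
    have hNT : (haveI := W.isElliptic_quadraticTwist (show ((-1 : ℤ) : ℚ) ≠ 0 by norm_num);
        (W.quadraticTwist ((-1 : ℤ) : ℚ)).conductorNorm ℤ) = (4 : ℕ) * W.conductorNorm ℤ := by
      push_cast; exact negOneTwistConductorFourMul_holds W h4 h8
    obtain ⟨W', i1, i2, i3, D', hD', hN', -, hc', hj'⟩ := exists_optimalPartner_general_j hnf W D hD h4 4 dvd_rfl
      (by obtain ⟨k, hk⟩ := h4; exact ⟨k, by rw [hk]; ring⟩) hNT
    have h16' : 2 ^ 4 ∣ W'.conductorNorm ℤ := by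
      rw [hN']; obtain ⟨k, hk⟩ := h4; exact ⟨k, by push_cast; rw [hk]; ring⟩
    rw [← hc']
    exact h16 W' D' hD' h16' (by rw [hj']; exact hss)

/-- **C2 on the potentially supersingular locus ⟸ its `16 ∣ N` stratum** (level pinned to the conductor by `IsNewformOf.level_eq_level`, then §2).
Both statements carry the crux's four printed-fact binders. [cite: DiamondShurman2005, Thm. 8.8.3 (modularity binder)] -/
theorem maninOddAtFourSS_of_maninOddAtSixteenSS
    (h16 : mazur_not_dvd_maninConstant_of_odd → abbesUllmo_not_dvd_maninConstant_of_not_dvd_level →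
      cesnavicius_not_two_dvd_maninConstant_of_two_dvd_level → exists_isNewformOf →
      ∀ (W : WeierstrassCurve ℚ) [W.IsElliptic] [W.IsGloballyMinimal] {N : ℕ} [NeZero N] (D : ModularParametrizationData W N),
        (∀ z ∈ D.L.lattice, ∃ w ∈ periodLattice D.f, z = D.c * w) → 2 ^ 4 ∣ N →
        ((primesEquiv (R := 𝓞 ℚ)).symm ⟨2, Nat.prime_two⟩).valuation ℚ W.j < 1 → ¬ (2 : ℤ) ∣ D.maninConstant) :
    mazur_not_dvd_maninConstant_of_odd → abbesUllmo_not_dvd_maninConstant_of_not_dvd_level →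
      cesnavicius_not_two_dvd_maninConstant_of_two_dvd_level → exists_isNewformOf →
      ∀ (W : WeierstrassCurve ℚ) [W.IsElliptic] [W.IsGloballyMinimal] {N : ℕ} [NeZero N] (D : ModularParametrizationData W N),
        (∀ z ∈ D.L.lattice, ∃ w ∈ periodLattice D.f, z = D.c * w) → 2 ^ 2 ∣ N →
        ((primesEquiv (R := 𝓞 ℚ)).symm ⟨2, Nat.prime_two⟩).valuation ℚ W.j < 1 → ¬ (2 : ℤ) ∣ D.maninConstant := by
  intro hMz hAU hCs hnf W _ _ N _ D hD h4 hss
  haveI : NeZero (W.conductorNorm ℤ) := ⟨(W.conductorNorm_pos_holds).ne'⟩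
  obtain ⟨g, hg⟩ := hnf W
  have hN : N = W.conductorNorm ℤ := IsNewformOf.level_eq_level D.isNewformOf hg
  subst hN
  refine two_not_dvd_c_of_four_dvd_of_sixteen_dvd_stratum_ss hnf ?_ W D hD h4 hss
  intro W' _ _ _ D' hD' h16' hss'
  exact h16 hMz hAU hCs hnf W' D' hD' h16' hss'

/-! ## §3 The by-locus level-wise composition with the `j`-binder threaded -/

/-- **C2 LEVEL-WISE on the potentially supersingular locus, the Kato law blind-guarded** — `not_two_dvd_maninConstant_of_levelLaws_blindGuard`
with the binder `ord₂ j > 0` carried to every law instance (the laws are consumed at the `a₁ = a₃ = 0` model `C • W`, `j(C • W) = j(W)` by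
`variableChange_j`, and at the `X₁(N)`-optimal curve through a guard naming that model).  Irreducible `W[2]`: F♯ via the Γ₁ road (no law).
CONDITIONAL reduction; nothing about BSD or Manin's conjecture is proved.
[cite: Kato2004Asterisque, Thm. 12.5 (1) (p. 221) (F♯)] [cite: ConradEdixhovenStein2003, §6.1.2 and §6.2 (F★)] [cite: Stevens1989, §2] -/
theorem not_two_dvd_maninConstant_of_levelLaws_blindGuard_ss
    (hF : kato_neron_isIntegral_twistedSymbolSum_of_additive_two_real)
    (hFstar : optimalGamma1Parametrization_cusp_rational) (hex : exists_optimal_gamma1ParametrizationData)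
    {N : ℕ} [NeZero N] (h4 : 2 ^ 2 ∣ N)
    (h48N : ∀ (V : WeierstrassCurve ℚ) [V.IsElliptic] [V.IsGloballyMinimal] (D : ModularParametrizationData V N)
      (a : ℕ → ℤ), (∀ n, (a n : ℂ) = cuspCoeff D.f n) →
      (∀ z ∈ D.L.lattice, ∃ w ∈ periodLattice D.f, z = D.c * w) →
      ((primesEquiv (R := 𝓞 ℚ)).symm ⟨2, Nat.prime_two⟩).valuation ℚ V.j < 1 →
      ∀ e : ℚ, V.twoTorsionPolynomial.toPoly.IsRoot e → ∀ z : ℚ⟦X⟧, IsParamGerm V D.c a z →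
      ∃ (r : ℕ → ℤ) (g A B : ℤ⟦X⟧), IsCuspidalKummerRep N (kummerSeries V D.c e z) r g A B)
    (h53N : ∀ (V : WeierstrassCurve ℚ) [V.IsElliptic] [V.IsGloballyMinimal] (D : ModularParametrizationData V N)
      (a : ℕ → ℤ), (∀ n, (a n : ℂ) = cuspCoeff D.f n) →
      (∀ z ∈ D.L.lattice, ∃ w ∈ periodLattice D.f, z = D.c * w) →
      ((primesEquiv (R := 𝓞 ℚ)).symm ⟨2, Nat.prime_two⟩).valuation ℚ V.j < 1 →
      ∀ (a₂ a₄ e : ℤ), V.a₁ = 0 → V.a₃ = 0 → V.a₂ = a₂ → V.a₄ = a₄ →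
      V.twoTorsionPolynomial.toPoly.IsRoot (e : ℚ) → ¬ KummerBlindAtTwo a₂ a₄ e →
      ∀ z : ℚ⟦X⟧, IsParamGerm V D.c a z →
      ∀ (r : ℕ → ℤ) (g A B : ℤ⟦X⟧), IsCuspidalKummerRep N (kummerSeries V D.c ((e : ℚ)) z) r g A B →
      ∃ δ ∈ N.divisors, Odd (r δ))
    (hKatoN : ∀ (V : WeierstrassCurve ℚ) [V.IsElliptic] [V.IsGloballyMinimal] (D₁ : Gamma1ParametrizationData V N),
      D₁.IsOptimal →
      (∃ (W₀ : WeierstrassCurve ℚ) (_ : W₀.IsElliptic) (_ : W₀.IsGloballyMinimal) (D₀ : ModularParametrizationData W₀ N),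
        IsIsogenous V W₀ ∧ (∀ z ∈ D₀.L.lattice, ∃ w ∈ periodLattice D₀.f, z = D₀.c * w) ∧
        W₀.a₁ = 0 ∧ W₀.a₃ = 0 ∧ HasRationalTwoTorsion W₀ ∧ AllRationalTwoTorsionBlind W₀ ∧
        ((primesEquiv (R := 𝓞 ℚ)).symm ⟨2, Nat.prime_two⟩).valuation ℚ W₀.j < 1) →
      KatoFactTwoAt V D₁.f)
    (W : WeierstrassCurve ℚ) [W.IsElliptic] [W.IsGloballyMinimal] (D : ModularParametrizationData W N)
    (hopt : ∀ z ∈ D.L.lattice, ∃ w ∈ periodLattice D.f, z = D.c * w)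
    (hss : ((primesEquiv (R := 𝓞 ℚ)).symm ⟨2, Nat.prime_two⟩).valuation ℚ W.j < 1) :
    ¬ (2 : ℤ) ∣ D.maninConstant := by
  by_cases hirr : W.HasIrreducibleModPGaloisRep 2
  · exact katoManinOddTwo_of_real_of_exists_gamma1 hF hex W D hopt h4 hirr
  have h4' : 4 ∣ N := by norm_num at h4; exact h4
  obtain ⟨h2, hN2⟩ := lFunction_two_eq_zero_of_four_dvd W D.isNewformOf h4'
  have hadd := hasAdditiveReductionAt_two_of_lFunction_two_eq_zero W h2 hN2
  obtain ⟨C, M, hu, hCW, hM1, hM3, hmin⟩ := exists_smul_eq_map_a₁_a₃_eq_zero_of_hasAdditiveReductionAt_two W hadd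
  haveI := hmin
  obtain ⟨D', hf, hc, hL, -⟩ := exists_modularParametrizationData_smul_of_u_eq_one W D C hu
  have hopt' : ∀ z ∈ D'.L.lattice, ∃ w ∈ periodLattice D'.f, z = D'.c * w := by
    rw [hL, hf, hc]; exact hopt
  have ha₁ : (C • W).a₁ = 0 := by rw [hCW, map_a₁, hM1, map_zero]
  have ha₃ : (C • W).a₃ = 0 := by rw [hCW, map_a₃, hM3, map_zero]
  have hssC : ((primesEquiv (R := 𝓞 ℚ)).symm ⟨2, Nat.prime_two⟩).valuation ℚ (C • W).j < 1 := by
    rw [variableChange_j]; exact hss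
  suffices h : ¬ (2 : ℤ) ∣ D'.maninConstant by
    change ¬ (2 : ℤ) ∣ D'.c at h
    change ¬ (2 : ℤ) ∣ D.c
    rwa [hc] at h
  by_cases hnb : HasNonBlindRationalTwoTorsion (C • W)
  · exact not_two_dvd_maninConstant_of_cuspidalKummerAt_of_hasNonBlind (C • W) D' h4 ha₁ ha₃ hnb
      (fun a ha => h48N (C • W) D' a ha hopt' hssC) (fun a ha => h53N (C • W) D' a ha hopt' hssC)
  · have hall : AllRationalTwoTorsionBlind (C • W) := (allBlind_or_hasNonBlind (C • W)).resolve_right hnb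
    have hred' : ¬ (C • W).HasIrreducibleModPGaloisRep 2 := by
      rwa [Mazur1978.hasIrreducibleModPGaloisRep_smul_iff]
    obtain ⟨e, he⟩ := exists_isRoot_twoTorsionPolynomial_of_not_hasIrreducibleModPGaloisRep_two (C • W) hred'
    have hT : HasRationalTwoTorsion (C • W) := ⟨e, (isRoot_twoTorsionPolynomial_iff_of_a₁_a₃ (C • W) ha₁ ha₃ e).mp he⟩
    obtain ⟨W₁, i₁, i₂, D₁, hiso, hD₁⟩ := hex (C • W) D' hopt'
    have hK : KatoFactTwoAt W₁ D₁.f :=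
      hKatoN W₁ D₁ hD₁ ⟨C • W, inferInstance, hmin, D', hiso, hopt', ha₁, ha₃, hT, hall, hssC⟩
    exact not_two_dvd_maninConstant_of_katoFactAt₁_of_allBlind hFstar W₁ (C • W) D₁ D' hiso hD₁ hopt' h4 ha₁ ha₃ hall hK

/-! ## §4 The composition of skeleton v19: laws READ ON {`16 ∣ N`} ∩ {`ord₂ j > 0`} -/

/-- **C2 on {`ord₂ j > 0`, `16 ∣ N`} ⟸ F♯ ∧ F★ ∧ hex ∧ F-es-21♭K ∧ the three laws READ THERE** (E-an-48 / E-an-53 at data whose curve is potentially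
supersingular at `2`; Kato–Néron integrality at the `X₁(N)`-optimal curve of TOTALLY BLIND potentially-supersingular classes off the
period-dominated locus), by §3 + the period-recut dispatcher.  CONDITIONAL; nothing about BSD, Manin's or Stevens' conjecture is proved.
[cite: Kato2004Asterisque, Thm. 12.5 (1) (p. 221)] [cite: ConradEdixhovenStein2003, §6.1.2 and §6.2] [cite: Stevens1989, §2] -/
theorem maninOddAtSixteenSS_of_katoFact_of_levelSixteenSSLaws_blindPeriodRecut
    (hF : kato_neron_isIntegral_twistedSymbolSum_of_additive_two_real)
    (hFstar : optimalGamma1Parametrization_cusp_rational) (hex : exists_optimal_gamma1ParametrizationData)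
    (hK : kato_isIntegral_twistedSymbolSum_two_symbolClosure)
    (h48 : ∀ (W : WeierstrassCurve ℚ) [W.IsElliptic] [W.IsGloballyMinimal] {N : ℕ} [NeZero N]
      (D : ModularParametrizationData W N) (a : ℕ → ℤ), (∀ n, (a n : ℂ) = cuspCoeff D.f n) →
      2 ^ 4 ∣ N → (∀ z ∈ D.L.lattice, ∃ w ∈ periodLattice D.f, z = D.c * w) →
      ((primesEquiv (R := 𝓞 ℚ)).symm ⟨2, Nat.prime_two⟩).valuation ℚ W.j < 1 →
      ∀ e : ℚ, W.twoTorsionPolynomial.toPoly.IsRoot e →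
      ∀ z : ℚ⟦X⟧, IsParamGerm W D.c a z →
      ∃ (r : ℕ → ℤ) (g A B : ℤ⟦X⟧), IsCuspidalKummerRep N (kummerSeries W D.c e z) r g A B)
    (h53 : ∀ (W : WeierstrassCurve ℚ) [W.IsElliptic] [W.IsGloballyMinimal] {N : ℕ} [NeZero N]
      (D : ModularParametrizationData W N) (a : ℕ → ℤ), (∀ n, (a n : ℂ) = cuspCoeff D.f n) →
      2 ^ 4 ∣ N → (∀ z ∈ D.L.lattice, ∃ w ∈ periodLattice D.f, z = D.c * w) →
      ((primesEquiv (R := 𝓞 ℚ)).symm ⟨2, Nat.prime_two⟩).valuation ℚ W.j < 1 →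
      ∀ (a₂ a₄ e : ℤ), W.a₁ = 0 → W.a₃ = 0 → W.a₂ = a₂ → W.a₄ = a₄ →
      W.twoTorsionPolynomial.toPoly.IsRoot (e : ℚ) → ¬ KummerBlindAtTwo a₂ a₄ e →
      ∀ z : ℚ⟦X⟧, IsParamGerm W D.c a z →
      ∀ (r : ℕ → ℤ) (g A B : ℤ⟦X⟧), IsCuspidalKummerRep N (kummerSeries W D.c ((e : ℚ)) z) r g A B →
      ∃ δ ∈ N.divisors, Odd (r δ))
    (h110 : ∀ (V : WeierstrassCurve ℚ) [V.IsElliptic] [V.IsGloballyMinimal] {N : ℕ} [NeZero N]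
      (D₁ : Gamma1ParametrizationData V N), D₁.IsOptimal → 2 ^ 4 ∣ N →
      (¬ ∃ (V' : WeierstrassCurve ℚ) (_ : V'.IsElliptic) (_ : V'.IsGloballyMinimal) (q m : ℤ),
        Odd q ∧ WeierstrassCurve.IsIsogenous V' V ∧ (q : ℝ) * V'.realPeriodRat = (m : ℝ) * V.realPeriodRat ∧
        IsSymbolClosureCurve V' D₁.f) →
      (∃ (W₀ : WeierstrassCurve ℚ) (_ : W₀.IsElliptic) (_ : W₀.IsGloballyMinimal) (D₀ : ModularParametrizationData W₀ N),
        IsIsogenous V W₀ ∧ (∀ z ∈ D₀.L.lattice, ∃ w ∈ periodLattice D₀.f, z = D₀.c * w) ∧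
        W₀.a₁ = 0 ∧ W₀.a₃ = 0 ∧ HasRationalTwoTorsion W₀ ∧ AllRationalTwoTorsionBlind W₀ ∧
        ((primesEquiv (R := 𝓞 ℚ)).symm ⟨2, Nat.prime_two⟩).valuation ℚ W₀.j < 1) →
      KatoFactTwoAt V D₁.f)
    :
    mazur_not_dvd_maninConstant_of_odd → abbesUllmo_not_dvd_maninConstant_of_not_dvd_level →
      cesnavicius_not_two_dvd_maninConstant_of_two_dvd_level → exists_isNewformOf →
      ∀ (W : WeierstrassCurve ℚ) [W.IsElliptic] [W.IsGloballyMinimal] {N : ℕ} [NeZero N] (D : ModularParametrizationData W N),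
        (∀ z ∈ D.L.lattice, ∃ w ∈ periodLattice D.f, z = D.c * w) → 2 ^ 4 ∣ N →
        ((primesEquiv (R := 𝓞 ℚ)).symm ⟨2, Nat.prime_two⟩).valuation ℚ W.j < 1 → ¬ (2 : ℤ) ∣ D.maninConstant := by
  intro _hMz _hAU _hCs _hnf W _ _ N _ D hopt h16 hss
  have h4 : 2 ^ 2 ∣ N := dvd_trans ⟨4, by norm_num⟩ h16
  exact not_two_dvd_maninConstant_of_levelLaws_blindGuard_ss hF hFstar hex h4
    (fun V _ _ D' a ha hopt' hssV => h48 V D' a ha h16 hopt' hssV)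
    (fun V _ _ D' a ha hopt' hssV => h53 V D' a ha h16 hopt' hssV)
    (fun V _ _ D₁ hD₁ hguard =>
      katoFactTwoAt_of_symbolClosure_of_periodRecut hK h4 V D₁ (fun hno => h110 V D₁ hD₁ h16 hno hguard)) W D hopt hss

/-- **THE ROUTE DECL `Theses.ManinLocalTwoThree.ManinOddAtFour` BY NAME from the seven inputs of skeleton v19** — the three laws READ ON
{`16 ∣ N`} ∩ {`ord₂ j > 0`}: §4, then the `j`-preserving rotation (§2) to {`4 ∣ N`} ∩ {`ord₂ j > 0`}, then p2's `maninOddAtFour_of_pos_ordJ`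
(the `ord₂ j ≤ 0` stratum is closed by the crux's own printed-fact binders).  CONDITIONAL reduction = the composition `ManinOddAtFour_of` of
skeleton v19; C2, Manin's conjecture and BSD are NOT proved.
[cite: Kato2004Asterisque, Thm. 12.5 (1) (p. 221)] [cite: ConradEdixhovenStein2003, §6.1.2 and §6.2] [cite: Stevens1989, §2 and Lemmas (5.2), (5.4)] -/
theorem maninOddAtFour_of_katoFact_of_levelSixteenSSLaws_blindPeriodRecut
    (hF : kato_neron_isIntegral_twistedSymbolSum_of_additive_two_real)
    (hFstar : optimalGamma1Parametrization_cusp_rational) (hex : exists_optimal_gamma1ParametrizationData)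
    (hK : kato_isIntegral_twistedSymbolSum_two_symbolClosure)
    (h48 : ∀ (W : WeierstrassCurve ℚ) [W.IsElliptic] [W.IsGloballyMinimal] {N : ℕ} [NeZero N]
      (D : ModularParametrizationData W N) (a : ℕ → ℤ), (∀ n, (a n : ℂ) = cuspCoeff D.f n) →
      2 ^ 4 ∣ N → (∀ z ∈ D.L.lattice, ∃ w ∈ periodLattice D.f, z = D.c * w) →
      ((primesEquiv (R := 𝓞 ℚ)).symm ⟨2, Nat.prime_two⟩).valuation ℚ W.j < 1 →
      ∀ e : ℚ, W.twoTorsionPolynomial.toPoly.IsRoot e →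
      ∀ z : ℚ⟦X⟧, IsParamGerm W D.c a z →
      ∃ (r : ℕ → ℤ) (g A B : ℤ⟦X⟧), IsCuspidalKummerRep N (kummerSeries W D.c e z) r g A B)
    (h53 : ∀ (W : WeierstrassCurve ℚ) [W.IsElliptic] [W.IsGloballyMinimal] {N : ℕ} [NeZero N]
      (D : ModularParametrizationData W N) (a : ℕ → ℤ), (∀ n, (a n : ℂ) = cuspCoeff D.f n) →
      2 ^ 4 ∣ N → (∀ z ∈ D.L.lattice, ∃ w ∈ periodLattice D.f, z = D.c * w) →
      ((primesEquiv (R := 𝓞 ℚ)).symm ⟨2, Nat.prime_two⟩).valuation ℚ W.j < 1 →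
      ∀ (a₂ a₄ e : ℤ), W.a₁ = 0 → W.a₃ = 0 → W.a₂ = a₂ → W.a₄ = a₄ →
      W.twoTorsionPolynomial.toPoly.IsRoot (e : ℚ) → ¬ KummerBlindAtTwo a₂ a₄ e →
      ∀ z : ℚ⟦X⟧, IsParamGerm W D.c a z →
      ∀ (r : ℕ → ℤ) (g A B : ℤ⟦X⟧), IsCuspidalKummerRep N (kummerSeries W D.c ((e : ℚ)) z) r g A B →
      ∃ δ ∈ N.divisors, Odd (r δ))
    (h110 : ∀ (V : WeierstrassCurve ℚ) [V.IsElliptic] [V.IsGloballyMinimal] {N : ℕ} [NeZero N]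
      (D₁ : Gamma1ParametrizationData V N), D₁.IsOptimal → 2 ^ 4 ∣ N →
      (¬ ∃ (V' : WeierstrassCurve ℚ) (_ : V'.IsElliptic) (_ : V'.IsGloballyMinimal) (q m : ℤ),
        Odd q ∧ WeierstrassCurve.IsIsogenous V' V ∧ (q : ℝ) * V'.realPeriodRat = (m : ℝ) * V.realPeriodRat ∧
        IsSymbolClosureCurve V' D₁.f) →
      (∃ (W₀ : WeierstrassCurve ℚ) (_ : W₀.IsElliptic) (_ : W₀.IsGloballyMinimal) (D₀ : ModularParametrizationData W₀ N),
        IsIsogenous V W₀ ∧ (∀ z ∈ D₀.L.lattice, ∃ w ∈ periodLattice D₀.f, z = D₀.c * w) ∧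
        W₀.a₁ = 0 ∧ W₀.a₃ = 0 ∧ HasRationalTwoTorsion W₀ ∧ AllRationalTwoTorsionBlind W₀ ∧
        ((primesEquiv (R := 𝓞 ℚ)).symm ⟨2, Nat.prime_two⟩).valuation ℚ W₀.j < 1) →
      KatoFactTwoAt V D₁.f)
    : Summit.BirchSwinnertonDyer.BirchSwinnertonDyer.Theses.ManinLocalTwoThree.ManinOddAtFour :=
  maninOddAtFour_of_pos_ordJ
    (maninOddAtFourSS_of_maninOddAtSixteenSS
      (maninOddAtSixteenSS_of_katoFact_of_levelSixteenSSLaws_blindPeriodRecut hF hFstar hex hK h48 h53 h110))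

/-! ## §5 v18's stubs ⟹ v19's (the `j`-binder only weakens each law) -/

/-- v18's Kato stub 6♭ ⟹ v19's 6♭ss (add the binder `ord₂ j(W₀) > 0` to the blind guard). [folklore] -/
theorem blindSSPeriodRecutLaw_of_blindPeriodRecutLaw
    (h110 : ∀ (V : WeierstrassCurve ℚ) [V.IsElliptic] [V.IsGloballyMinimal] {N : ℕ} [NeZero N]
      (D₁ : Gamma1ParametrizationData V N), D₁.IsOptimal → 2 ^ 4 ∣ N →
      (¬ ∃ (V' : WeierstrassCurve ℚ) (_ : V'.IsElliptic) (_ : V'.IsGloballyMinimal) (q m : ℤ),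
        Odd q ∧ WeierstrassCurve.IsIsogenous V' V ∧ (q : ℝ) * V'.realPeriodRat = (m : ℝ) * V.realPeriodRat ∧
        IsSymbolClosureCurve V' D₁.f) →
      (∃ (W₀ : WeierstrassCurve ℚ) (_ : W₀.IsElliptic) (_ : W₀.IsGloballyMinimal) (D₀ : ModularParametrizationData W₀ N),
        IsIsogenous V W₀ ∧ (∀ z ∈ D₀.L.lattice, ∃ w ∈ periodLattice D₀.f, z = D₀.c * w) ∧
        W₀.a₁ = 0 ∧ W₀.a₃ = 0 ∧ HasRationalTwoTorsion W₀ ∧ AllRationalTwoTorsionBlind W₀) →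
      KatoFactTwoAt V D₁.f) :
    ∀ (V : WeierstrassCurve ℚ) [V.IsElliptic] [V.IsGloballyMinimal] {N : ℕ} [NeZero N]
      (D₁ : Gamma1ParametrizationData V N), D₁.IsOptimal → 2 ^ 4 ∣ N →
      (¬ ∃ (V' : WeierstrassCurve ℚ) (_ : V'.IsElliptic) (_ : V'.IsGloballyMinimal) (q m : ℤ),
        Odd q ∧ WeierstrassCurve.IsIsogenous V' V ∧ (q : ℝ) * V'.realPeriodRat = (m : ℝ) * V.realPeriodRat ∧
        IsSymbolClosureCurve V' D₁.f) →
      (∃ (W₀ : WeierstrassCurve ℚ) (_ : W₀.IsElliptic) (_ : W₀.IsGloballyMinimal) (D₀ : ModularParametrizationData W₀ N),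
        IsIsogenous V W₀ ∧ (∀ z ∈ D₀.L.lattice, ∃ w ∈ periodLattice D₀.f, z = D₀.c * w) ∧
        W₀.a₁ = 0 ∧ W₀.a₃ = 0 ∧ HasRationalTwoTorsion W₀ ∧ AllRationalTwoTorsionBlind W₀ ∧
        ((primesEquiv (R := 𝓞 ℚ)).symm ⟨2, Nat.prime_two⟩).valuation ℚ W₀.j < 1) →
      KatoFactTwoAt V D₁.f := by
  intro V _ _ N _ D₁ hD₁ h16 hno hguard
  obtain ⟨W₀, i₀, i₀', D₀, hiso, hopt₀, ha₁, ha₃, hT, hall, -⟩ := hguard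
  exact h110 V D₁ hD₁ h16 hno ⟨W₀, i₀, i₀', D₀, hiso, hopt₀, ha₁, ha₃, hT, hall⟩

end Summit.BirchSwinnertonDyer.BirchSwinnertonDyer.Theorems.ManinLocalTwoThree

end
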